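import Literature.IUT.HodgeTheaters.PMBaseBridgePropsProofs2

/-!
# Proof of [IUTchI] Proposition 6.5 (iii): the bijection `(†ζ_±)⁻¹` and the composite of the four `ζ`'s

Mochizuki, *Inter-universal Teichmüller theory I*, §6, Proposition 6.5 (iii) pp. 164–165, kurims
manuscript (May 2020). PROOF-ONLY companion (theorems, no definitions) to abc-iut-L5-t4's
`PMBaseBridgeProps.lean`, by the L5 discharge seat abc-iut-L5-t13. Both named statements typed there for
Prop 6.5 (iii) are PROVED for every `𝒟-Θ^{±ell}`-Hodge theater over every base kit:

* `DThetaPMEllHT.ZetaPMInvSpec` — "the assignment `T ∋ t ↦ †ζ^{Θell}_t(0)` … determines a [single,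
  well-defined!] bijection `(†ζ_±)⁻¹ : T ⥲ LabCusp^±(†𝒟^{⊚±})` which is compatible with the respective
  `𝔽_l^±`-torsor structures" (`zetaPMInvSpec`);
* `DThetaPMEllHT.ZetaCompositeIsTranslation` — "the composite bijection
  `(†ζ^{Θell}_0)⁻¹ ∘ (†ζ^{Θell}_t) ∘ (†ζ^{Θ±}_t)⁻¹ ∘ (†ζ^{Θ±}_0)` coincides with the automorphism of the set
  `LabCusp^±(†𝔇_0)` determined, relative to the `𝔽_l^±`-group structure on this set, by the action of
  `(†ζ^{Θell}_0)⁻¹((†ζ_±)⁻¹(t))`" (`zetaCompositeIsTranslation`).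

Mechanism: the `ζ`'s are unique (every member of the poly-morphism induces them), hence equal to the ones
assembled from model coordinates (`DThetaEllBridge.zetaCandidate` of `PMBaseDischarge.lean`); the composite
is then `LabCusp^±(α_0) ∘ L_v⁻¹ ∘ (translation by z − z₀) ∘ L_v ∘ LabCusp^±(α_0)⁻¹`, and conjugating a
translation of the torsor `LabCusp^±(𝒟^{⊚±})` back along the bijection `L_v` induced by `φ^{Θell}_{•,v}`
gives a translation of the group `LabCusp^±(𝒟_v)` because `L_v` carries group charts to torsor charts
(the v2 interface field `labOfHom_phiEll_charts`) — no synchronisation across `v` is needed here.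
Record only; [claim: Mochizuki2012, status: disputed]; nothing here takes a side on any disputed step.
-/

namespace Literature.IUT.HodgeTheaters

open CategoryTheory

universe u

/-! ### Group-compatible bijections preserve the zero element -/

namespace FlPMGroup

variable {l : ℕ} {E₁ E₂ : Type*} (S₁ : FlPMGroup l E₁) (S₂ : FlPMGroup l E₂)

/-- A bijection compatible with the `𝔽_l^±`-group structures carries zero to zero.
[claim: Mochizuki2012, status: disputed] -/
theorem map_zero_of_compat (φ : E₁ ≃ E₂) (h : ∀ e ∈ S₂.charts, φ.trans e ∈ S₁.charts) :
    φ S₁.zero = S₂.zero := by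
  have h0 := S₁.chart_zero (h _ S₂.chart₀_mem)
  rw [Equiv.trans_apply] at h0
  change φ S₁.zero = S₂.chart₀.symm 0
  rw [Equiv.eq_symm_apply]
  exact h0

end FlPMGroup

namespace PMBaseKit

variable {l : ℕ} {K : PMBaseKit.{u} l}

/-! ### Uniqueness of the `ζ`'s: they are the ones read off model coordinates -/

namespace DThetaEllBridge

/-- Every member of a conjugate `ellConj α_z β (φ^{Θell}_{v_z})` of the model poly-morphism induces, on
`±`-label classes, the candidate bijection `zetaCandidate v (α_z v) β z` (the computation inside
`inducesZeta`, exported). [claim: Mochizuki2012, status: disputed] -/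
theorem labOfHom_of_mem_ellConj {C : K.DStrip} {G : K.Glob} (αz : (DStrip.model K).Iso C) (β : K.gModel ≅ G)
    (z : ZMod l) (v : K.V) {h : C.obj v ⟶ (K.atV v).obj G}
    (hh : h ∈ K.ellConj αz β v (Ex63.poly K z v)) :
    K.labOfHom v h = zetaCandidate v (αz v) β z := by
  obtain ⟨f, ⟨a, ha, b, hb, rfl⟩, rfl⟩ := hh
  obtain ⟨a, rfl⟩ : ∃ a' : K.model v ≅ K.model v, a' = a := ⟨a, rfl⟩
  obtain ⟨b, rfl⟩ : ∃ b' : K.gModel ≅ K.gModel, b' = b := ⟨b, rfl⟩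
  generalize αz v = αzv
  have ha' : K.labMap v a = Equiv.refl _ := (K.mem_autPlus_iff a).mp ha
  have hb' : K.gLabMap b = gTransl K z := hb.2
  have e1 : αzv.inv ≫ (a.hom ≫ K.phiEll v ≫ (K.atV v).map b.hom) ≫ (K.atV v).map β.hom =
      (αzv.symm ≪≫ a).hom ≫ (K.phiEll v ≫ (K.atV v).map (b ≪≫ β).hom) := by
    simp [Functor.map_comp, Category.assoc]
  rw [e1, K.labOfHom_pre, K.labOfHom_post, K.labMap_trans, K.gLabMap_trans, ha', hb']
  funext x
  simp [zetaCandidate]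

/-- Conjugates of the model `Θ^{ell}`-poly-morphisms are nonempty. [claim: Mochizuki2012, status: disputed] -/
theorem ellConj_nonempty {C : K.DStrip} {G : K.Glob} (αz : (DStrip.model K).Iso C) (β : K.gModel ≅ G)
    (z : ZMod l) (v : K.V) : (K.ellConj αz β v (Ex63.poly K z v)).Nonempty := by
  obtain ⟨b, hb⟩ := Ex63.lifts_nonempty (K := K) (FlPM.transl z)
  exact ⟨_, (1 : Aut (K.model v)).hom ≫ K.phiEll v ≫ (K.atV v).map b.hom, ⟨1, one_mem _, b, hb, rfl⟩, rfl⟩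

/-- **Uniqueness of `†ζ^{Θell}_{v_t}`**: any bijection satisfying `ZetaSpec` at `t = ι z` IS the candidate
read off exhibiting coordinates `(ι, α, β)` ("[single, well-defined!]", [IUTchI] Prop 6.5 (i) p. 163).
[claim: Mochizuki2012, status: disputed] -/
theorem zeta_eq_zetaCandidate (B : K.DThetaEllBridge) {ι : ZMod l ≃ B.T}
    {α : ∀ z, (DStrip.model K).Iso (B.capsule (ι z))} {β : K.gModel ≅ B.glob}
    (hpoly : ∀ z v, B.poly (ι z) v = K.ellConj (α z) β v (Ex63.poly K z v)) (z : ZMod l) (v : K.V)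
    {ζ : K.LabCuspPM v ((B.capsule (ι z)).obj v) ≃ K.GLab B.glob} (hζ : B.ZetaSpec (ι z) v ζ) :
    ζ = zetaCandidate v (α z v) β z := by
  obtain ⟨f, hf⟩ := ellConj_nonempty (α z) β z v
  have h1 := hζ.1 f (by rw [hpoly z v]; exact hf)
  rw [labOfHom_of_mem_ellConj (α z) β z v hf] at h1
  exact (Equiv.coe_inj.mp h1).symm

end DThetaEllBridge

namespace DThetaPMBridge

/-- **Uniqueness of `†ζ^{Θ±}_{v_t}`**: any bijection satisfying `ZetaSpec` at `t = ι z` is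
`LabCusp^±(α_{z,v})⁻¹` followed by `LabCusp^±(β_v)` for exhibiting coordinates `(ι, α, β)`.
[claim: Mochizuki2012, status: disputed] -/
theorem zeta_eq (B : K.DThetaPMBridge) {ι : ZMod l ≃ B.T}
    {α : ∀ z, (DStrip.model K).Iso (B.capsule (ι z))} {β : (DStrip.model K).Iso B.codomain}
    (hpoly : ∀ z, B.poly (ι z) = DStrip.polyConj (α z) β (Ex62.poly K z)) (z : ZMod l) (v : K.V)
    {ζ : K.LabCuspPM v ((B.capsule (ι z)).obj v) ≃ K.LabCuspPM v (B.codomain.obj v)} (hζ : B.ZetaSpec (ι z) v ζ) :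
    ζ = (K.labMap v (α z v).symm).trans (K.labMap v (β v)) := by
  have hmem : ((α z).symm.trans (DStrip.Iso.refl _)).trans β ∈ B.poly (ι z) := by
    rw [hpoly z]
    exact ⟨_, DStrip.refl_mem_signedPolyAut_one _, rfl⟩
  have h1 := hζ.1 _ hmem
  change K.labMap v (((α z v).symm ≪≫ Iso.refl _) ≪≫ β v) = ζ at h1
  rw [Iso.trans_refl, K.labMap_trans] at h1
  exact h1.symm

end DThetaPMBridge

/-! ### Proposition 6.5 (iii) -/

namespace DThetaPMEllHT

variable (H : K.DThetaPMEllHT)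

/-- **[IUTchI] Prop 6.5 (iii), first sentence — DISCHARGED**: `T ∋ t ↦ †ζ^{Θell}_t(0) ∈ LabCusp^±(†𝒟^{⊚±})`
is a bijection compatible with the `𝔽_l^±`-torsor structures (the named statement `ZetaPMInvSpec`),
read at any `v ∈ 𝕍`. [claim: Mochizuki2012, status: disputed] -/
theorem zetaPMInvSpec : H.ZetaPMInvSpec := by
  intro v ζ hζ
  obtain ⟨ι, hι, α, β, γ, -, hE⟩ := H.exists_model
  have hιT := indexEquiv_torsor_charts H.grpT ι hι
  -- the `ζ`'s are the candidates
  have hζeq : ∀ z, ζ (ι z) = DThetaEllBridge.zetaCandidate v (α z v) γ z := fun z =>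
    H.ellBridge.zeta_eq_zetaCandidate (ι := ι) (α := α) (β := γ) hE z v (hζ (ι z))
  -- the zero element of `LabCusp^±(†𝒟_{v_t})` goes to the zero element of `LabCusp^±(𝒟_v)`
  let S : FlPMGroup l (K.LabCuspPM v (K.model v)) := K.labPM v (K.model v) ⟨Iso.refl _⟩
  have hzero : ∀ z, K.labMap v (α z v).symm (K.labPM v _ ((H.capsule (ι z)).isLocal v)).zero = S.zero :=
    fun z => FlPMGroup.map_zero_of_compat _ _ _
      (K.labMap_charts v ((H.capsule (ι z)).isLocal v) ⟨Iso.refl _⟩ (α z v).symm)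
  -- the explicit form of `t ↦ ζ_t(0)` in the coordinate `z = ι⁻¹ t`
  let L := Equiv.ofBijective _ (K.labOfHom_phiEll_bijective v)
  let k : ZMod l := K.gChart₀ (L S.zero)
  have hF : (fun t => ζ t (K.labPM v _ ((H.capsule t).isLocal v)).zero) =
      fun t => K.gLabMap γ (K.gChart₀.symm (ι.symm t + k)) := by
    funext t
    obtain ⟨z, rfl⟩ := ι.surjective t
    rw [hζeq z]
    simp [DThetaEllBridge.zetaCandidate, DThetaEllBridge.gTransl, hzero z, k, L, add_comm]
  have hbij : Function.Bijective fun t => ζ t (K.labPM v _ ((H.capsule t).isLocal v)).zero := by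
    rw [hF]
    exact (ι.symm.trans ((Equiv.addRight k).trans (K.gChart₀.symm.trans (K.gLabMap γ)))).bijective
  refine ⟨hbij, γ, ⟨ι, hιT, α, hE⟩, fun e he => ?_⟩
  -- torsor compatibility: a chart of the transported torsor reads `z ↦ g • (z + k)` in the coordinate `z`
  have he' : (K.gLabMap γ).trans e ∈ K.gLabT.charts := he
  obtain ⟨g, hg⟩ := K.gLabT.exists_of_mem K.gChart₀_mem he'
  have hcomp : (Equiv.ofBijective _ hbij).trans e = ι.symm.trans (FlPM.toPerm l (g * FlPM.transl k)) := by
    ext t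
    have h1 : (Equiv.ofBijective _ hbij) t = K.gLabMap γ (K.gChart₀.symm (ι.symm t + k)) :=
      congrFun hF t
    have h2 := congrArg (fun f : K.GLab K.gModel ≃ ZMod l => f (K.gChart₀.symm (ι.symm t + k))) hg
    simp only [Equiv.trans_apply, Equiv.apply_symm_apply] at h2
    simp only [Equiv.trans_apply, h1, h2, FlPM.toPerm_apply, mul_smul, FlPM.transl_smul]
  rw [hcomp]
  exact H.grpT.toTorsor.symm_trans_mem_of_compat hιT ⟨g * FlPM.transl k, rfl⟩

/-- **[IUTchI] Prop 6.5 (iii), second sentence — DISCHARGED**: the composite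
`(†ζ^{Θell}_0)⁻¹ ∘ †ζ^{Θell}_t ∘ (†ζ^{Θ±}_t)⁻¹ ∘ †ζ^{Θ±}_0` is, on `LabCusp^±(†𝔇_0)` (read at `v`), the
translation by `(†ζ^{Θell}_0)⁻¹(†ζ^{Θell}_t(0))` for the `𝔽_l^±`-group structure (the named statement
`ZetaCompositeIsTranslation`). [claim: Mochizuki2012, status: disputed] -/
theorem zetaCompositeIsTranslation : H.ZetaCompositeIsTranslation := by
  intro v t ζP0 ζPt ζE0 ζEt hP0 hPt hE0 hEt S₀ x e he y
  obtain ⟨ι, hι, α, β, γ, hP, hE⟩ := H.exists_model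
  -- `α` transported to arbitrary indices
  let αT : ∀ s : H.T, (DStrip.model K).Iso (H.capsule s) := fun s w =>
    α (ι.symm s) w ≪≫ eqToIso (congrArg (fun r => (H.capsule r).obj w) (ι.apply_symm_apply s))
  have hαT : ∀ z, αT (ι z) = α z := fun z =>
    DStrip.isoCast_eq (fun r => H.capsule (ι r)) _ α (ι.symm_apply_apply z)
  -- all four `ζ`'s in closed form
  have hPgen : ∀ (s : H.T) (ζ : K.LabCuspPM v ((H.capsule s).obj v) ≃ K.LabCuspPM v (H.codomain.obj v)),
      H.pmBridge.ZetaSpec s v ζ → ζ = (K.labMap v (αT s v).symm).trans (K.labMap v (β v)) := by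
    intro s ζ hζ
    obtain ⟨z, rfl⟩ := ι.surjective s
    rw [hαT]
    exact H.pmBridge.zeta_eq (ι := ι) (α := α) (β := β) hP z v hζ
  have hEgen : ∀ (s : H.T) (ζ : K.LabCuspPM v ((H.capsule s).obj v) ≃ K.GLab H.glob),
      H.ellBridge.ZetaSpec s v ζ → ζ = DThetaEllBridge.zetaCandidate v (αT s v) γ (ι.symm s) := by
    intro s ζ hζ
    obtain ⟨z, rfl⟩ := ι.surjective s
    rw [hαT, Equiv.symm_apply_apply]
    exact H.ellBridge.zeta_eq_zetaCandidate (ι := ι) (α := α) (β := γ) hE z v hζ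
  have e0 := hPgen _ _ hP0
  have et := hPgen _ _ hPt
  have f0 := hEgen _ _ hE0
  have ft := hEgen _ _ hEt
  subst e0 et f0 ft
  -- notation: the model group at `v`, the bijection `L_v`, the chart `e` moved to the model object
  let S : FlPMGroup l (K.LabCuspPM v (K.model v)) := K.labPM v (K.model v) ⟨Iso.refl _⟩
  let L := Equiv.ofBijective _ (K.labOfHom_phiEll_bijective v)
  have heM : (K.labMap v (αT H.grpT.zero v)).trans e ∈ S.charts :=
    K.labMap_charts v ⟨Iso.refl _⟩ ((H.capsule H.grpT.zero).isLocal v) (αT H.grpT.zero v) e he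
  -- `e ∘ LabCusp^±(α_0) ∘ L⁻¹` is a chart of the torsor `LabCusp^±(𝒟^{⊚±})`: it reads `w ↦ g • gChart₀ w`
  obtain ⟨g, hg⟩ := K.gLabT.exists_of_mem K.gChart₀_mem (K.labOfHom_phiEll_charts v _ heM)
  have hread : ∀ m : K.LabCuspPM v (K.model v),
      e (K.labMap v (αT H.grpT.zero v) m) = g • K.gChart₀ (L m) := by
    intro m
    have hm := congrArg (fun f : K.GLab K.gModel ≃ ZMod l => f (L m)) hg
    simpa [L] using hm
  -- the zero of `LabCusp^±(†𝒟_{v_t})` maps to the zero of the model group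
  have hzero : K.labMap v (αT t v).symm (K.labPM v _ ((H.capsule t).isLocal v)).zero = S.zero :=
    FlPMGroup.map_zero_of_compat _ _ _ (K.labMap_charts v ((H.capsule t).isLocal v) ⟨Iso.refl _⟩ (αT t v).symm)
  -- a group chart kills the zero of the model group: `g • gChart₀ (L 0) = 0`
  have hg0 : g • K.gChart₀ (L S.zero) = 0 := by
    have h := S.chart_zero heM
    rw [Equiv.trans_apply, hread] at h
    exact h
  have hzero' : (K.labMap v (αT t v)).symm (K.labPM v _ ((H.capsule t).isLocal v)).zero = S.zero := by
    rw [← labMap_symm]; exact hzero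
  have hsy : ∀ u, (FlPM.toPerm l (FlPM.transl (ι.symm H.grpT.zero))).symm u = u - ι.symm H.grpT.zero := by
    intro u
    rw [Equiv.symm_apply_eq, FlPM.toPerm_apply, FlPM.transl_smul, sub_add_cancel]
  -- evaluate both sides at `y = LabCusp^±(α_0) m`
  have hy : ∃ m, y = K.labMap v (αT H.grpT.zero v) m :=
    ⟨K.labMap v (αT H.grpT.zero v).symm y, by rw [labMap_symm, Equiv.apply_symm_apply]⟩
  obtain ⟨m, rfl⟩ := hy
  simp only [x, Equiv.trans_apply, Equiv.symm_trans_apply, DThetaEllBridge.zetaCandidate,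
    DThetaEllBridge.gTransl, Equiv.symm_symm, labMap_symm, Equiv.symm_apply_apply,
    Equiv.apply_symm_apply, hsy, hzero', FlPM.toPerm_apply, FlPM.transl_smul]
  rw [hread, hread, hread]
  simp only [L, Equiv.apply_symm_apply] at hg0 ⊢
  simp only [FlPM.smul_def, Units.smul_def, zsmul_eq_mul, mul_add, mul_sub] at hg0 ⊢
  linear_combination -hg0

end DThetaPMEllHT

end PMBaseKit

end Literature.IUT.HodgeTheaters
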